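import Summits.KontsevichZagierPeriods.KontsevichZagierPeriods.Theses.LinkTwistWrithe
import Summits.KontsevichZagierPeriods.KontsevichZagierPeriods.Theses.AyoubSpecialisation
import Summits.KontsevichZagierPeriods.KontsevichZagierPeriods.Theorems.HurwitzMicroSectorsNormalFormPrincipleSplitGlue
import Literature.NumberTheory.Transcendental.KZSubcalculusInvariants

/-!
# Census sketch (strategist scratch): the STRENGTHEN and NEGATION signatures of STRATEGY-CENSUS.md, elaborated

* `FoldedMoser` (S⁺₂): ONE signed sheet family between two equal-volume compact bodies — `[A] − 1 • [B] ∈ degreeRel`.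
* `FoldedGKZ` (S⁺₃): Newton–Leibniz-free generation for volume representations in the enlarged calculus.
* `DimLEOneDegreeKernel` (T2 / D7 sector): the crux restricted to combinations supported in dimension ≤ 1.
* `not_degreeKernel_of_not_kzKernel`-direction bookkeeping (N0): ¬crux → ¬KZKernelConjecture is NOT available;
  what IS: ¬KZKernelConjecture ← ¬crux fails, while ¬crux → ¬summit… see census. Here we only record the
  contrapositive that makes the negation lens void: `¬ DegreeKernel → ¬ KZKernelConjecture`.
-/

noncomputable section

namespace Summit.KontsevichZagierPeriods.LinkTwistWrithe.DegreeKernelCensus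

open Set MeasureTheory
open Literature.NumberTheory.Transcendental
open Summit.KontsevichZagierPeriods.KontsevichZagierPeriods.Theses.LinkTwistWrithe (DegreeKernel DegreeTransfer)
open Summit.KontsevichZagierPeriods.KontsevichZagierPeriods.Theses.AyoubSpecialisation
  (AyoubPiLocalKernel AyoubPiCancellation)

/-! ## The enlarged calculus `R'` (verbatim from the crux) -/

/-- The SIGNED-DEGREE RELATORS (fourth generator set of the route's enlarged calculus), copied
verbatim from the body of `DegreeKernel`: finite families of `ℚ`-semialgebraic sheets `σ k ⊆ r.domain`
(co-null union), injective differentiable `ℚ`-semialgebraic maps `Φ k` into `r'.domain` with integer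
weights `ε k` and a.e.-constant signed sheet count `d`, the integrand identity
`r.integrand = Σ_k 1_{σ k} · ε k · (r'.integrand ∘ Φ k) · |det Φ' k|`, and the relator `[r] − d • [r']`.
[cite: KontsevichZagier2001, §1.2 rule (2)] -/
def degreeRel : Set KZ.FormalRep :=
  {c | ∃ (n N : ℕ) (d : ℤ) (ε : Fin N → ℤ) (r r' : Literature.NumberTheory.Transcendental.KZ.IntegralRep n) (σ : Fin N → Set (Fin n → ℝ)) (Φ : Fin N → (Fin n → ℝ) → (Fin n → ℝ)) (Φ' : Fin N → (Fin n → ℝ) → ((Fin n → ℝ) →L[ℝ] (Fin n → ℝ))), (∀ k, Literature.ModelTheory.ExponentialFields.IsSemialgebraic ℚ (σ k)) ∧ (∀ k, σ k ⊆ r.domain) ∧ MeasureTheory.volume (r.domain \ ⋃ k, σ k) = 0 ∧ (∀ k, Literature.NumberTheory.Transcendental.IsSemialgebraicMapOn ℚ (σ k) (Φ k)) ∧ (∀ k, ∀ x ∈ σ k, HasFDerivWithinAt (Φ k) (Φ' k x) (σ k) x) ∧ (∀ k, Set.InjOn (Φ k) (σ k)) ∧ (∀ k, Φ k '' σ k ⊆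 r'.domain) ∧ (∀ᵐ y ∂(MeasureTheory.volume.restrict r'.domain), (∑ k : Fin N, (Φ k '' σ k).indicator (fun _ => ε k) y) = d) ∧ (∀ x ∈ ⋃ k, σ k, r.integrand x = ∑ k : Fin N, (σ k).indicator (fun y => (ε k : ℝ) * (r'.integrand (Φ k y) * |(Φ' k y).det|)) x) ∧ c = Literature.NumberTheory.Transcendental.KZ.of r - d • Literature.NumberTheory.Transcendental.KZ.of r'}

/-- The relation subgroup `R'` of the enlarged calculus: generated by (1a), (1b), (3) and the
signed-degree relators. [cite: KontsevichZagier2001, §1.2] -/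
def enlargedRelations : AddSubgroup KZ.FormalRep :=
  AddSubgroup.closure (KZ.domainAddRel ∪ KZ.integrandAddRel ∪ KZ.newtonLeibnizRel ∪ degreeRel)

/-! ## Rule (2) is the one-sheet signed-degree relator -/

/-- **Rule (2) is the one-sheet signed-degree relator** (the registered stub `stub_oneSheet` of line
`Lines/birth.lean` of this crux, same statement): a `changeOfVariablesRel` instance `(r, r', Φ, Φ')`
is the degree datum with `N = 1`, the single sheet `σ 0 = r.domain` (semialgebraic, exhausting the
domain), the map `Φ` (semialgebraic, differentiable within the sheet, injective), image
`Φ '' r.domain = r'.domain`, weight `ε 0 = 1`, signed count `d = 1` on all of `r'.domain` (hence a.e.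
for `volume.restrict r'.domain`, the domain being measurable), integrand identity
`f = 1 · (f' ∘ Φ) · |det Φ'|` on the sheet, and `[r] − (1 : ℤ) • [r'] = [r] − [r']`.
[cite: KontsevichZagier2001, §1.2 rule (2)] -/
theorem changeOfVariablesRel_subset_degreeRel : KZ.changeOfVariablesRel ⊆ degreeRel := by
  rintro c ⟨n, r, r', Φ, Φ', hsa, hder, hinj, hdom, hf, rfl⟩
  refine ⟨n, 1, 1, fun _ => 1, r, r', fun _ => r.domain, fun _ => Φ, fun _ => Φ',
    ?_, ?_, ?_, ?_, ?_, ?_, ?_, ?_, ?_, ?_⟩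
  · intro _; exact r.isSemialgebraic_domain
  · intro _; exact Subset.rfl
  · simp [Set.iUnion_const]
  · intro _; exact hsa
  · intro _ x hx; exact hder x hx
  · intro _; exact hinj
  · intro _; rw [hdom]
  · refine ae_restrict_of_forall_mem (KZ.IntegralRep.measurableSet_domain_holds r') fun y hy => ?_
    have hy' : y ∈ Φ '' r.domain := hdom ▸ hy
    simp [Set.indicator_of_mem hy']
  · intro x hx
    have hx' : x ∈ r.domain := by simpa [Set.iUnion_const] using hx
    simp [Set.indicator_of_mem hx', hf x hx']
  · simp

/-- **Every KZ relation is an `R'` relation**: (1a), (1b), (3) are generators of both, and rule (2)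
is the one-sheet signed-degree relator (`changeOfVariablesRel_subset_degreeRel`).
[cite: KontsevichZagier2001, §1.2] -/
theorem relations_le_enlargedRelations : KZ.relations ≤ enlargedRelations := by
  refine (AddSubgroup.closure_le _).mpr ?_
  rintro c (((hc | hc) | hc) | hc)
  · exact AddSubgroup.subset_closure (Or.inl (Or.inl (Or.inl hc)))
  · exact AddSubgroup.subset_closure (Or.inl (Or.inl (Or.inr hc)))
  · exact AddSubgroup.subset_closure (Or.inr (changeOfVariablesRel_subset_degreeRel hc))
  · exact AddSubgroup.subset_closure (Or.inl (Or.inr hc))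

/-- The kernel conjecture for KZ's own calculus gives the crux (one-sheet absorption): if
`ker eval ≤ KZ.relations` then `ker eval ≤ R'`. [cite: KontsevichZagier2001, §1.2 Conjecture 1] -/
theorem degreeKernel_of_kzKernelConjecture (h : KZKernelConjecture) : DegreeKernel :=
  fun c hc => relations_le_enlargedRelations (h c hc)

/-! ## The decomposition: `Sub₁ → Sub₂ → DegreeKernel` -/

/-- **The `[π]`-split of `DegreeKernel` glues** (crux-strategist decomposition of
stmt-KontsevichZagierPeriods-4303 onto the shared items stmt-0541 / stmt-0540, by the names of route
AyoubSpecialisation): `AyoubPiLocalKernel → AyoubPiCancellation → DegreeKernel`. Pinned product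
(`exists_pinnedProduct`) → `π`-local kernel gives `(lift (of ∘ P))^[N] c ∈ KZ.relations` for
`c ∈ ker eval` → `π`-cancellation peels the `N` factors (induction on `N`) →
`relations_le_enlargedRelations`. [cite: Ayoub2014, Def. 6 and Conj. 7] -/
theorem DegreeKernel_of_subs : AyoubPiLocalKernel → AyoubPiCancellation → DegreeKernel := by
  intro h₁ h₂
  -- a pinned product `[π] ⋆ ·` exists
  obtain ⟨P, hP⟩ :=
    Summit.KontsevichZagierPeriods.HurwitzMicroSectors.NormalFormPrincipleSplitGlue.exists_pinnedProduct
  intro c hc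
  -- 0541: some `[π]^N ⋆ c` is a KZ relation
  obtain ⟨N, hN⟩ := h₁ P hP c hc
  -- 0540 peels the `N` factors `[π]`
  have hrel : c ∈ KZ.relations := by
    clear hc
    induction N with
    | zero => simpa using hN
    | succ N ih =>
      exact ih (h₂ P hP _ (by simpa only [Function.iterate_succ_apply'] using hN))
  -- KZ relations are `R'` relations
  exact relations_le_enlargedRelations hrel



/-- S⁺₂ "folded Moser": equal-volume compact top-dimensional bodies are related by ONE signed-degree relator. -/
def FoldedMoser : Prop :=
  ∀ ⦃d : ℕ⦄ (A B : KZ.IntegralRep d), IsCompact A.domain → (interior A.domain).Nonempty →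
    IsCompact B.domain → (interior B.domain).Nonempty →
    (∀ x ∈ A.domain, A.integrand x = 1) → (∀ x ∈ B.domain, B.integrand x = 1) →
    A.value = B.value → KZ.of A - (1 : ℤ) • KZ.of B ∈ degreeRel

/-- S⁺₃ "folded GKZ" (Cresson–Viu-Sos Conj. 1.1 pointed at the enlarged calculus): scissors + signed-degree relators
generate the volume kernel, WITHOUT Newton–Leibniz or integrand additivity. -/
def FoldedGKZ : Prop :=
  ∀ ⦃d : ℕ⦄ (A B : KZ.IntegralRep d), IsCompact A.domain → (interior A.domain).Nonempty →
    IsCompact B.domain → (interior B.domain).Nonempty →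
    (∀ x ∈ A.domain, A.integrand x = 1) → (∀ x ∈ B.domain, B.integrand x = 1) →
    A.value = B.value → KZ.of A - KZ.of B ∈ AddSubgroup.closure (KZ.domainAddRel ∪ degreeRel)

/-- T2 / D7: the dimension-≤ 1 sector of the crux (the statement a Huber–Wüstholz transcription would reach). -/
def DimLEOneDegreeKernel : Prop :=
  ∀ c : KZ.FormalRep, KZ.eval c = 0 →
    c ∈ AddSubgroup.closure (Set.range (fun s : (Σ n : Fin 2, KZ.IntegralRep n) => KZ.of s.2)) →
    c ∈ enlargedRelations

/-- S⁺₂ ⇒ S⁺-chain: folded Moser gives the folded volume kernel (birth's stub 2) in one step. -/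
theorem foldedVolumeKernel_of_foldedMoser (h : FoldedMoser) :
    ∀ ⦃d : ℕ⦄ (A B : KZ.IntegralRep d), IsCompact A.domain → (interior A.domain).Nonempty →
      IsCompact B.domain → (interior B.domain).Nonempty →
      (∀ x ∈ A.domain, A.integrand x = 1) → (∀ x ∈ B.domain, B.integrand x = 1) →
      A.value = B.value → KZ.of A - KZ.of B ∈ enlargedRelations := by
  intro d A B hA hAi hB hBi hA1 hB1 hv
  have := h A B hA hAi hB hBi hA1 hB1 hv
  rw [one_zsmul] at this
  exact AddSubgroup.subset_closure (Or.inr this)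

/-- S⁺₃ ⇒ birth's stub 2 as well (closure monotonicity). -/
theorem foldedVolumeKernel_of_foldedGKZ (h : FoldedGKZ) :
    ∀ ⦃d : ℕ⦄ (A B : KZ.IntegralRep d), IsCompact A.domain → (interior A.domain).Nonempty →
      IsCompact B.domain → (interior B.domain).Nonempty →
      (∀ x ∈ A.domain, A.integrand x = 1) → (∀ x ∈ B.domain, B.integrand x = 1) →
      A.value = B.value → KZ.of A - KZ.of B ∈ enlargedRelations := by
  intro d A B hA hAi hB hBi hA1 hB1 hv
  refine AddSubgroup.closure_mono ?_ (h A B hA hAi hB hBi hA1 hB1 hv)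
  rintro x (hx | hx)
  · exact Or.inl (Or.inl (Or.inl hx))
  · exact Or.inr hx

/-- The crux gives its dimension-≤ 1 sector for free (D7: the sector is a CONSEQUENCE; the complement is the crux). -/
theorem dimLEOne_of_degreeKernel (h : DegreeKernel) : DimLEOneDegreeKernel :=
  fun c hc _ => h c hc

/-- N0: the negation lens is void BY THEOREM — a counterexample to the crux refutes Conjecture 1 itself. -/
theorem not_kzKernelConjecture_of_not_degreeKernel (h : ¬ DegreeKernel) : ¬ KZKernelConjecture :=
  fun hK => h (degreeKernel_of_kzKernelConjecture hK)

/-- N1: the two elementary sub-calculus invariants of the tree do not survive the full move set: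
`coeffSum` is `−1` on the additivity moves (so it does not vanish on `R'`). -/
example {c : KZ.FormalRep} (hc : c ∈ KZ.domainAddRel) : KZ.coeffSum c = -1 :=
  KZ.coeffSum_eq_neg_one_of_mem_domainAddRel hc

end Summit.KontsevichZagierPeriods.LinkTwistWrithe.DegreeKernelCensus

end
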